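import Summits.ResolutionOfSingularities.ResolutionOfSingularities.Theorems.EquisingularLiftEquisingularLiftNatTowerReachLettersDefs
import HarnessLib

/-!
# [OURS · L1 W4.5(b) · EL♮(3)] S-T56′ — THE A⁗ PREFIX REACH DELIVERS A CLOSED `T` ON A LOCALLY NOETHERIAN `F`
# (`isClosed_and_isLocallyNoetherian_of_prefixReachBQuadPrime`; tower halves `…_of_reachTowerBQuadPrime` / `…_of_reachTowerBTriplePrime`)

res-L1-w45b-stub-2 g15.  The slot S-T56′ `PrefixReachClosedLN k n` of res-L1-w45b-idea-1's SPEC K6-loc (v6 c3fde465b9a5a3fa, l.≈495; res-L1-w45b-crit-3's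
S-T56′; desk RULING R36 (L-P) «typed as a named statement, proof optional») asks: every stage `(F, ρ, T)` reached from `(ℙⁿ_k, 𝟙, range ι)` through blob #21's
motive closure (`PrefixReachBQuadPrime k n H ι F ρ T`: point steps, B‴ towers `ReachTowerBTriplePrime` at any stage, lettered B⁗ towers `ReachTowerBQuadPrime`
at the initial stage) has `T` CLOSED and `F` LOCALLY NOETHERIAN.  Consumer (desk D2 UPDATE 2026-08-28T16:31:10Z (5)): with it blob #21 `IsoHypDefTowerBQuadPrime`
is the `m = 0` sub-case of (K6-1P) `IsoHypReachNDLeavesP` (`isoHypReachNDLeavesP_of_isoHypDefTowerBQuadPrime`, PROVED in the SPEC modulo this slot), so the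
38th registration may REPLACE hypotheses #19/#21 by `¬ IsoHypReachNDLeavesP`.

HONEST NOTE ON THE SLOT AS TYPED.  `PrefixReachClosedLN k n` quantifies over ALL `ι : H ⟶ ℙⁿ_k`; the EMPTY prefix reaches `(ℙⁿ_k, 𝟙, range ι)` itself, so the
slot asserts `IsClosed (Set.range ι)` for every morphism `ι` — false for `n ≥ 1` (an open immersion `𝔸ⁿ_k ↪ ℙⁿ_k`).  The statement proved here carries the
one binder the consumer has anyway (the crux's `IsClosedImmersion ι`); the slot should read `∀ H ι, IsClosedImmersion ι → ∀ F ρ T, PrefixReachBQuadPrime … →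
IsClosed T ∧ IsLocallyNoetherian F` (a one-line instance of the theorem below once `PrefixReachBQuadPrime` is ported to `Theorems/`; here its body is UNFOLDED,
so this file is def-free and imports no workfile).

PROOF (pure bookkeeping, no mathematics): the motive `Q F ρ T := IsClosed T ∧ IsLocallyNoetherian F` is closed under every clause — each step is a blow-up
`υ` (proper, hence locally of finite type: `IsBlowup.isProper`, `LocallyOfFiniteType.isLocallyNoetherian`) and every new `T` is a `closure`; inside the towers
the same motive is run through `InCarrierReachKSs` and through `TowerPtRegB₄` / `TowerPtRamB₄` / `TowerRoundBTriplePrime`.  OURS; NOT a statement of any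
manuscript; AI-written, weaker than expert review.  No `sorry`; standard axioms; DEF-FREE.  `--supports stmt-ResolutionOfSingularities-20148 --as helper`.
-/

set_option linter.dupNamespace false -- mandated namespace `Summit.<Summit>.<Problem>` of this single-conjunct summit

noncomputable section

open CategoryTheory CategoryTheory.Limits AlgebraicGeometry TopologicalSpace Topology IsLocalRing
open Literature.AlgebraicGeometry.Resolution
open AlgebraicGeometry.Scheme.IdealSheafData

namespace Summit.ResolutionOfSingularities.ResolutionOfSingularities.Cruxes.EquisingularLiftNat.Sections

/-- A blow-up of a locally Noetherian scheme is locally Noetherian (proper ⇒ locally of finite type). [folklore] -/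
theorem isLocallyNoetherian_of_isBlowup {G G' : Scheme.{0}} [IsLocallyNoetherian G] {υ : G' ⟶ G} {J : G.IdealSheafData}
    (hυ : IsBlowup υ J) : IsLocallyNoetherian G' := by
  haveI : IsProper υ := hυ.isProper
  exact LocallyOfFiniteType.isLocallyNoetherian υ

/-- The three B‴ tower step constructors preserve the motive «`T` closed ∧ ambient locally Noetherian» (each step is a blow-up and the new `T` is a closure).
[OURS · bookkeeping] -/
theorem towerSteps_closedLN (F₉ F₁₀ : Scheme.{0}) (υ' : F₁₀ ⟶ F₉) (Z₉ : Set F₉) (hZ₉ : IsClosed Z₉) :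
    TowerPtRegB₄ F₁₀ (fun G _ T _ _ _ _ => IsClosed T ∧ IsLocallyNoetherian G) ∧
      TowerPtRamB₄ F₁₀ (fun G _ T _ _ _ _ => IsClosed T ∧ IsLocallyNoetherian G) ∧
      TowerRoundBTriplePrime F₉ F₁₀ υ' Z₉ hZ₉ (fun G _ T _ _ _ _ => IsClosed T ∧ IsLocallyNoetherian G) := by
  refine ⟨?_, ?_, ?_⟩
  · intro G G' γ T E Es Ns K y υ₂ hy K' E' Es' Ns' hR _ _ hυ₂ _ _ _ _
    haveI := hR.2
    exact ⟨isClosed_closure, isLocallyNoetherian_of_isBlowup hυ₂⟩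
  · intro G G' γ T E Es Ns K y J υ₂ K' E' Es' Ns' hR _ _ _ _ hυ₂ _ _ _ _
    haveI := hR.2
    exact ⟨isClosed_closure, isLocallyNoetherian_of_isBlowup hυ₂⟩
  · intro G G' γ T E Es Ns K hE Z hZ Hst W υ₂ K' E' Es' Ns' hR _ _ _ hυ₂ _ _
    haveI := hR.2
    exact ⟨isClosed_closure, isLocallyNoetherian_of_isBlowup hυ₂⟩

/-- **Tower half (lettered B⁗ tower):** from a locally Noetherian `F₂`, every `ReachTowerBQuadPrime`-reachable `(F', β, T')` has `T'` closed and `F'`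
locally Noetherian (the in-carrier point phase `InCarrierReachKSs` and the carrier round keep the ambient locally Noetherian; the round phase's seed and steps
produce closures). [OURS · bookkeeping] -/
theorem isClosed_and_isLocallyNoetherian_of_reachTowerBQuadPrime (F₁ F₂ : Scheme.{0}) (υ : F₂ ⟶ F₁) (x : F₁) (T₂ : Set F₂) (Ls₂ : List (Set F₂))
    (F' : Scheme.{0}) (β : F' ⟶ F₂) (T' : Set F') (hF₂ : IsLocallyNoetherian F₂)
    (h : ReachTowerBQuadPrime F₁ F₂ υ x T₂ Ls₂ F' β T') : IsClosed T' ∧ IsLocallyNoetherian F' := by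
  obtain ⟨W, K₂, F₉, β₉, T₉, Z₉, K₉, S₉, Ps₉, Ms₉, b₉, hZ₉, F₁₀, υ', Es₁₀, Ns₁₀, γ', E', Es', Ns', K', -, -, -, -, -, hIC, -, -, -, -, hυ', -, -, hcl, -⟩ := h
  -- the in-carrier point phase keeps the ambient locally Noetherian
  have hF₉ : IsLocallyNoetherian F₉ := by
    refine hIC (fun G _ _ _ _ _ _ _ _ => IsLocallyNoetherian G) hF₂ ?_ ?_
    · intro G₁ G₂ β T Z K S Ps Ms b y υ₁ hy Ps' Ms' hR _ _ _ hυ₁ _ _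
      haveI : IsLocallyNoetherian G₁ := hR
      exact isLocallyNoetherian_of_isBlowup hυ₁
    · intro G₁ G₂ β T Z K S Ps Ms y υ₁ hy Ps' Ms' hR _ _ _ hυ₁ _ _
      haveI : IsLocallyNoetherian G₁ := hR
      exact isLocallyNoetherian_of_isBlowup hυ₁
  haveI := hF₉
  have hF₁₀ : IsLocallyNoetherian F₁₀ := isLocallyNoetherian_of_isBlowup hυ'
  obtain ⟨h1, h2, h3⟩ := towerSteps_closedLN F₉ F₁₀ υ' Z₉ hZ₉
  exact hcl (fun G _ T _ _ _ _ => IsClosed T ∧ IsLocallyNoetherian G) ⟨isClosed_closure, hF₁₀⟩ h1 h2 h3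

/-- **Tower half (B‴ tower)** = the lettered one at `Ls₂ = []` (`reachTowerBQuadPrime_nil_iff`). [OURS · bookkeeping] -/
theorem isClosed_and_isLocallyNoetherian_of_reachTowerBTriplePrime (F₁ F₂ : Scheme.{0}) (υ : F₂ ⟶ F₁) (x : F₁) (T₂ : Set F₂)
    (F' : Scheme.{0}) (β : F' ⟶ F₂) (T' : Set F') (hF₂ : IsLocallyNoetherian F₂)
    (h : ReachTowerBTriplePrime F₁ F₂ υ x T₂ F' β T') : IsClosed T' ∧ IsLocallyNoetherian F' :=
  isClosed_and_isLocallyNoetherian_of_reachTowerBQuadPrime F₁ F₂ υ x T₂ [] F' β T' hF₂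
    ((reachTowerBQuadPrime_nil_iff F₁ F₂ υ x T₂ F' β T').mpr h)

/-- **S-T56′ (repaired: `ι` a closed immersion): THE A⁗ PREFIX REACH DELIVERS A CLOSED `T` ON A LOCALLY NOETHERIAN `F`.**  Hypothesis = the body of
`PrefixReachBQuadPrime k n H ι F ρ T` (SPEC K6 / K6-loc; = blob #21 `IsoHypDefTowerBQuadPrime`'s `∀ Q`-part) UNFOLDED.  See the module docstring.
[OURS · bookkeeping] -/
theorem isClosed_and_isLocallyNoetherian_of_prefixReachBQuadPrime (k : Type) [Field k] [IsAlgClosed k] (n : ℕ) (H : AlgebraicGeometry.Scheme.{0})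
    (ι : H ⟶ (Literature.AlgebraicGeometry.Motives.projectiveSpace n k).left) [AlgebraicGeometry.IsClosedImmersion ι] (F : AlgebraicGeometry.Scheme.{0})
    (ρ : F ⟶ (Literature.AlgebraicGeometry.Motives.projectiveSpace n k).left) (T : Set F)
    (h : (∀ Q : (∀ F₁ : AlgebraicGeometry.Scheme.{0}, (F₁ ⟶ (Literature.AlgebraicGeometry.Motives.projectiveSpace n k).left) → Set F₁ →
      Prop), Q (Literature.AlgebraicGeometry.Motives.projectiveSpace n k).left (CategoryTheory.CategoryStruct.id (Literature.AlgebraicGeometry.Motives.projectiveSpace n k).left) (Set.range ι)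
      →
      (∀ (F₁ F₂ : AlgebraicGeometry.Scheme.{0}) (ρ : F₁ ⟶ (Literature.AlgebraicGeometry.Motives.projectiveSpace n k).left) (T₁ : Set F₁) (x : ↥(AlgebraicGeometry.Scheme.IdealSheafData.vanishingIdeal (⟨closure T₁, isClosed_closure⟩ : TopologicalSpace.Closeds F₁)).subscheme) (υ : F₂ ⟶ F₁) (hx : IsClosed ({((AlgebraicGeometry.Scheme.IdealSheafData.vanishingIdeal (⟨closure T₁, isClosed_closure⟩ : TopologicalSpace.Closeds F₁)).subschemeι x : F₁)} : Set F₁)), Q F₁ ρ T₁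
      →
      ¬ IsRegularLocalRing ((AlgebraicGeometry.Scheme.IdealSheafData.vanishingIdeal (⟨closure T₁, isClosed_closure⟩ : TopologicalSpace.Closeds F₁)).subscheme.presheaf.stalk x)
      →
      IsRegularLocalRing (F₁.presheaf.stalk ((AlgebraicGeometry.Scheme.IdealSheafData.vanishingIdeal (⟨closure T₁, isClosed_closure⟩ : TopologicalSpace.Closeds F₁)).subschemeι x))
      →
      Literature.AlgebraicGeometry.Resolution.IsBlowup υ (AlgebraicGeometry.Scheme.IdealSheafData.vanishingIdeal (⟨{((AlgebraicGeometry.Scheme.IdealSheafData.vanishingIdeal (⟨closure T₁, isClosed_closure⟩ : TopologicalSpace.Closeds F₁)).subschemeι x : F₁)}, hx⟩ : TopologicalSpace.Closeds F₁))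
      →
      Q F₂ (CategoryTheory.CategoryStruct.comp υ ρ) (closure (υ ⁻¹' (T₁ \ {((AlgebraicGeometry.Scheme.IdealSheafData.vanishingIdeal (⟨closure T₁, isClosed_closure⟩ : TopologicalSpace.Closeds F₁)).subschemeι x : F₁)})))
      ∧
      (∀ (F₉ : AlgebraicGeometry.Scheme.{0}) (β : F₉ ⟶ F₂) (T₉ : Set F₉), ReachTowerBTriplePrime F₁ F₂ υ ((AlgebraicGeometry.Scheme.IdealSheafData.vanishingIdeal (⟨closure T₁, isClosed_closure⟩ : TopologicalSpace.Closeds F₁)).subschemeι x) (closure (υ ⁻¹' (T₁ \ {((AlgebraicGeometry.Scheme.IdealSheafData.vanishingIdeal (⟨closure T₁, isClosed_closure⟩ : TopologicalSpace.Closeds F₁)).subschemeι x : F₁)}))) F₉ β T₉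
      → Q F₉ (CategoryTheory.CategoryStruct.comp (CategoryTheory.CategoryStruct.comp β υ) ρ) T₉))  →
      (∀ (F₂ : AlgebraicGeometry.Scheme.{0}) (x₀ : ↥(AlgebraicGeometry.Scheme.IdealSheafData.vanishingIdeal (⟨closure (Set.range ι), isClosed_closure⟩ : TopologicalSpace.Closeds (Literature.AlgebraicGeometry.Motives.projectiveSpace n k).left)).subscheme) (υ : F₂ ⟶ (Literature.AlgebraicGeometry.Motives.projectiveSpace n k).left) (hx₀ : IsClosed ({((AlgebraicGeometry.Scheme.IdealSheafData.vanishingIdeal (⟨closure (Set.range ι), isClosed_closure⟩ : TopologicalSpace.Closeds (Literature.AlgebraicGeometry.Motives.projectiveSpace n k).left)).subschemeι x₀ : (Literature.AlgebraicGeometry.Motives.projectiveSpace n k).left)} : Set (Literature.AlgebraicGeometry.Motives.projectiveSpace n k).left)) (Ls₂ : List (Set F₂)), ¬ IsRegularLocalRing ((AlgebraicGeometry.Scheme.IdealSheafData.vanishingIdeal (⟨closure (Set.range ι), isClosed_closure⟩ : TopologicalSpace.Closeds (Literature.AlgebraicGeometry.Motives.projectiveSpace n k).left)).subscheme.presheaf.stalk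 x₀)
      →
      IsRegularLocalRing (((Literature.AlgebraicGeometry.Motives.projectiveSpace n k).left).presheaf.stalk ((AlgebraicGeometry.Scheme.IdealSheafData.vanishingIdeal (⟨closure (Set.range ι), isClosed_closure⟩ : TopologicalSpace.Closeds (Literature.AlgebraicGeometry.Motives.projectiveSpace n k).left)).subschemeι x₀ : (Literature.AlgebraicGeometry.Motives.projectiveSpace n k).left))
      →
      Literature.AlgebraicGeometry.Resolution.IsBlowup υ (AlgebraicGeometry.Scheme.IdealSheafData.vanishingIdeal (⟨{((AlgebraicGeometry.Scheme.IdealSheafData.vanishingIdeal (⟨closure (Set.range ι), isClosed_closure⟩ : TopologicalSpace.Closeds (Literature.AlgebraicGeometry.Motives.projectiveSpace n k).left)).subschemeι x₀ : (Literature.AlgebraicGeometry.Motives.projectiveSpace n k).left)}, hx₀⟩ : TopologicalSpace.Closeds (Literature.AlgebraicGeometry.Motives.projectiveSpace n k).left))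
      → (letI := MvPolynomial.gradedAlgebra (σ := Fin (n + 1)) (R := k); ∀ L ∈ Ls₂, ∃ ℓ : MvPolynomial (Fin (n + 1)) k, ℓ.IsHomogeneous 1 ∧ ℓ ≠ 0 ∧
      ((AlgebraicGeometry.Scheme.IdealSheafData.vanishingIdeal (⟨closure (Set.range ι), isClosed_closure⟩ : TopologicalSpace.Closeds (Literature.AlgebraicGeometry.Motives.projectiveSpace n k).left)).subschemeι x₀ : (Literature.AlgebraicGeometry.Motives.projectiveSpace n k).left) ∈ {y : (Literature.AlgebraicGeometry.Motives.projectiveSpace n k).left | ℓ ∈ (y : ProjectiveSpectrum (MvPolynomial.homogeneousSubmodule (Fin (n + 1)) k)).asHomogeneousIdeal}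
      ∧
      ¬ (Set.range ι ⊆ {y : (Literature.AlgebraicGeometry.Motives.projectiveSpace n k).left | ℓ ∈ (y : ProjectiveSpectrum (MvPolynomial.homogeneousSubmodule (Fin (n + 1)) k)).asHomogeneousIdeal})
      ∧
      L = closure (υ ⁻¹' ({y : (Literature.AlgebraicGeometry.Motives.projectiveSpace n k).left | ℓ ∈ (y : ProjectiveSpectrum (MvPolynomial.homogeneousSubmodule (Fin (n + 1)) k)).asHomogeneousIdeal} \ {((AlgebraicGeometry.Scheme.IdealSheafData.vanishingIdeal (⟨closure (Set.range ι), isClosed_closure⟩ : TopologicalSpace.Closeds (Literature.AlgebraicGeometry.Motives.projectiveSpace n k).left)).subschemeι x₀ : (Literature.AlgebraicGeometry.Motives.projectiveSpace n k).left)})))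
      →
      ∀ (F₉ : AlgebraicGeometry.Scheme.{0}) (β : F₉ ⟶ F₂) (T₉ : Set F₉), ReachTowerBQuadPrime (Literature.AlgebraicGeometry.Motives.projectiveSpace n k).left F₂ υ ((AlgebraicGeometry.Scheme.IdealSheafData.vanishingIdeal (⟨closure (Set.range ι), isClosed_closure⟩ : TopologicalSpace.Closeds (Literature.AlgebraicGeometry.Motives.projectiveSpace n k).left)).subschemeι x₀ : (Literature.AlgebraicGeometry.Motives.projectiveSpace n k).left) (closure (υ ⁻¹' (Set.range ι \ {((AlgebraicGeometry.Scheme.IdealSheafData.vanishingIdeal (⟨closure (Set.range ι), isClosed_closure⟩ : TopologicalSpace.Closeds (Literature.AlgebraicGeometry.Motives.projectiveSpace n k).left)).subschemeι x₀ : (Literature.AlgebraicGeometry.Motives.projectiveSpace n k).left)}))) Ls₂ F₉ β T₉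
      → Q F₉ (CategoryTheory.CategoryStruct.comp β υ) T₉) → Q F ρ T)) :
    IsClosed T ∧ IsLocallyNoetherian F := by
  haveI hPLN : IsLocallyNoetherian (Literature.AlgebraicGeometry.Motives.projectiveSpace n k).left :=
    LocallyOfFiniteType.isLocallyNoetherian (Literature.AlgebraicGeometry.Motives.projectiveSpace n k).hom
  refine h (fun F₁ _ T₁ => IsClosed T₁ ∧ IsLocallyNoetherian F₁) ⟨ι.isClosedEmbedding.isClosed_range, hPLN⟩ ?_ ?_
  · -- point step at any stage, then B‴ towers
    intro F₁ F₂ ρ₁ T₁ x υ hx hQ _ _ hυ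
    haveI := hQ.2
    have hF₂ : IsLocallyNoetherian F₂ := isLocallyNoetherian_of_isBlowup hυ
    exact ⟨⟨isClosed_closure, hF₂⟩, fun F₉ β T₉ hR =>
      isClosed_and_isLocallyNoetherian_of_reachTowerBTriplePrime F₁ F₂ υ _ _ F₉ β T₉ hF₂ hR⟩
  · -- lettered B⁗ towers at the initial stage
    intro F₂ x₀ υ hx₀ Ls₂ _ _ hυ _ F₉ β T₉ hR
    have hF₂ : IsLocallyNoetherian F₂ := isLocallyNoetherian_of_isBlowup hυ
    exact isClosed_and_isLocallyNoetherian_of_reachTowerBQuadPrime _ F₂ υ _ _ Ls₂ F₉ β T₉ hF₂ hR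

end Summit.ResolutionOfSingularities.ResolutionOfSingularities.Cruxes.EquisingularLiftNat.Sections

end
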